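import Summits.NavierStokesRegularity.NavierStokesRegularity.Theorems.ExtremiserTransienceNearExtremalTransienceExtremiserLiouvilleConstantSpeedTruncationExpansion
import Summits.NavierStokesRegularity.NavierStokesRegularity.Theorems.ExtremiserTransienceKStarAttainedHalfSpaceVariation
import Literature.Analysis.FluidPDE.WholeSpaceIBP
import HarnessLib

/-!
# Crux `ExtremiserTransience.NearExtremalTransience` (stmt-NavierStokesRegularity-21883), line `extremiser_liouville`,
# stub K1b — THE FAR-FIELD CACCIOPPOLI INEQUALITY: the localised stretching is absorbed, no `DV → 0` needed

`--supports stmt-NavierStokesRegularity-21883` (helper).  Author: prover seat `ns-el-k1b` (g7).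

The localised KKT inequality of the residue object (`…ConstantSpeedTruncationExpansion.localisedKKT_expanded`, g5) reads
`κ⋆²M²(W·Z_θ + Z·W_θ) ≤ 3S·S_θ + (∇θ-cross terms) − S·∫⟪ω, D∇p ω⟫ + κ⋆²MZW·η`, `S_θ = ∫θ⟪ω, DV ω⟫`.  The records of
g5/g6 bounded the localised stretching by `|S_θ| ≤ sup_{supp θ}‖DV‖ · Z_θ`, which left the alternative «(α) the velocity
GRADIENT does not decay along the jet» open (item (N12′)).  This file removes (α) for free: moving the derivative from `V`
onto `ω ⊗ ω` (exactly as in the proof of the trivial bound `|S| ≤ M√Z√W`),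

* `integral_weightedStretching_eq` — for `ω = curl v` (`v ∈ C^∞`, so `div ω = 0`), ANY `C¹` field `U` and every weight
  `θ ∈ C^∞_c`:  `∫θ⟪ω, DU ω⟫ = −∫θ⟪U, Dω ω⟫ − ∫(Dθ ω)⟪ω, U⟫` (divergence theorem for the `C¹_c` field `θ⟪ω,U⟫ω`);
* `abs_integral_weightedStretching_le` — with `U = v − c` and `σ ≥ sup_{tsupport θ}‖v − c‖`:
  `|S_θ| ≤ σ·√Z_θ·√W_θ + σ·∫‖Dθ‖‖ω‖²` (`Z_θ = ∫θ‖ω‖²`, `W_θ = ∫θ|Dω|²_F`);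

so the small factor is the far-field SPEED DEFICIT `σ = sup‖v − c‖ → 0` (a hypothesis of the residue), not `sup‖DV‖`.
Since `|S| = κ⋆M√Z√W`, `3|S|σ√(Z_θW_θ) ≤ (3σ/(κ⋆M))·κ⋆²M²·(WZ_θ + ZW_θ)/2`, and for `σ ≤ κ⋆M/3` the localised stretching
is ABSORBED by the left-hand side:

* `farCaccioppoli_of_gradient_corrector` — for the constant-speed residue, every `θ ∈ C^∞_c(ℝ³;[0,1])` whose support lies
  where `‖v − c‖ ≤ σ ≤ κ⋆M/3`, and every smooth gradient corrector `∇p` of `(1−θ)(v−c)` with `‖∇p‖ ≤ η`: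
  `½κ⋆²M²(W·Z_θ + Z·W_θ) ≤ 3|S|σ∫‖Dθ‖‖ω‖² + |S|·|J_×| + κ⋆²M²(W|A_×| + Z|C_×|) + |S|·|∫⟪ω, D∇p ω⟫| + κ⋆²MZW·η`
  (`A_×, J_×, C_×` the explicit `∇θ`-cross integrals of `…TruncationExpansion`).

This is a genuine Caccioppoli (reverse-Poincaré) inequality for the Euler–Lagrange system of the residue on far regions:
the enstrophy + palinstrophy of any far region is controlled by cut-off cross terms and the corrector's sup-norm excess alone.
The dichotomy (α)/(β) of the g6 record (`Lines/extremiser_liouville_k1b_jet.md` §8) collapses to (β).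

WHAT THIS IS NOT: K1b is NOT proved; nothing here proves NS regularity. [folklore]
-/

noncomputable section

open Set Filter Topology MeasureTheory Metric Function Real
open scoped ENNReal NNReal Topology InnerProductSpace RealInnerProductSpace ContDiff
open Literature.Analysis.FluidPDE Literature.Analysis

namespace Summit.NavierStokesRegularity.NavierStokesRegularity.Theorems

-- the problem directory repeats the summit name (`NavierStokesRegularity/NavierStokesRegularity`)
set_option linter.dupNamespace false

namespace ExtremiserLiouville

open DepletionLadder.KStar DepletionLadder.KStar.HalfSpace

variable {v : E3 → E3} {c : E3} {θ : E3 → ℝ}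

/-! ## 1. The localised stretching by parts: the derivative moves from `U` onto `ω ⊗ ω` -/

/-- **`∫θ⟪ω, DU ω⟫ = −∫θ⟪U, Dω ω⟫ − ∫(Dθ ω)⟪ω, U⟫`** for `ω = curl v` (`v ∈ C^∞`, hence `div ω = 0`), any `C¹` field `U`
and any weight `θ ∈ C^∞_c` (divergence theorem for the compactly supported `C¹` field `x ↦ (θ(x)⟪ω(x), U(x)⟫)·ω(x)`). [folklore] -/
theorem integral_weightedStretching_eq (hv : ContDiff ℝ ∞ v) {U : E3 → E3} (hU : ContDiff ℝ 1 U)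
    (hθ : ContDiff ℝ ∞ θ) (hθc : HasCompactSupport θ) :
    (∫ x, θ x * ⟪curl v x, fderiv ℝ U x (curl v x)⟫) =
      -(∫ x, θ x * ⟪U x, fderiv ℝ (curl v) x (curl v x)⟫) - ∫ x, (fderiv ℝ θ x (curl v x)) * ⟪curl v x, U x⟫ := by
  set om : E3 → E3 := curl v with homdef
  have hω : ContDiff ℝ ∞ om := contDiff_curl_top hv
  have hω1 : ContDiff ℝ 1 om := hω.of_le (by norm_cast)
  have hθ1 : ContDiff ℝ 1 θ := hθ.of_le (by norm_cast)
  have hωd : Differentiable ℝ om := hω1.differentiable one_ne_zero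
  have hUd : Differentiable ℝ U := hU.differentiable one_ne_zero
  have hθd : Differentiable ℝ θ := hθ1.differentiable one_ne_zero
  -- the scalar factor `f = θ⟪om, U⟫` and the field `X = f • om`
  set f : E3 → ℝ := fun y => θ y * ⟪om y, U y⟫ with hfdef
  have hf1 : ContDiff ℝ 1 f := hθ1.mul (hω1.inner ℝ hU)
  have hfc : HasCompactSupport f := hθc.mul_right
  have hX1 : ContDiff ℝ 1 (fun y => f y • om y) := hf1.smul hω1
  have hXc : HasCompactSupport (fun y => f y • om y) := hfc.smul_right
  -- `div om = 0`
  have hdivω : ∀ x, VectorCalculus.divergence om x = 0 := fun x =>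
    divergence_curl_eq_zero_holds v (hv.of_le (by norm_cast)) x
  -- the derivative of `f` along `om`
  have hDf : ∀ x, fderiv ℝ f x (om x) =
      fderiv ℝ θ x (om x) * ⟪om x, U x⟫ + θ x * (⟪om x, fderiv ℝ U x (om x)⟫ + ⟪fderiv ℝ om x (om x), U x⟫) := by
    intro x
    have h : HasFDerivAt f (θ x • ((fderivInnerCLM ℝ (om x, U x)).comp ((fderiv ℝ om x).prod (fderiv ℝ U x))) +
        ⟪om x, U x⟫ • fderiv ℝ θ x) x :=
      (hθd x).hasFDerivAt.mul ((hωd x).hasFDerivAt.inner ℝ (hUd x).hasFDerivAt)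
    rw [h.fderiv]
    simp only [_root_.add_apply, FunLike.coe_smul, Pi.smul_apply, ContinuousLinearMap.comp_apply,
      ContinuousLinearMap.prod_apply, fderivInnerCLM_apply, smul_eq_mul]
    ring
  -- pointwise divergence of `X`
  have hpt : ∀ x, VectorCalculus.divergence (fun y => f y • om y) x =
      fderiv ℝ θ x (om x) * ⟪om x, U x⟫ + θ x * ⟪U x, fderiv ℝ om x (om x)⟫ + θ x * ⟪om x, fderiv ℝ U x (om x)⟫ := by
    intro x
    rw [divergence_smul_apply (hf1.differentiable one_ne_zero x) (hωd x), hdivω x, mul_zero, zero_add,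
      real_inner_comm, gradient, InnerProductSpace.toDual_symm_apply, hDf x,
      real_inner_comm (U x) (fderiv ℝ om x (om x))]
    ring
  have h0 := integral_divergence_eq_zero hX1 hXc
  simp_rw [hpt] at h0
  -- integrability of the three pieces (continuous, compactly supported)
  have cω : Continuous om := hω.continuous
  have cDω : Continuous (fderiv ℝ om) := hω.continuous_fderiv (by simp)
  have cDU : Continuous (fderiv ℝ U) := hU.continuous_fderiv one_ne_zero
  have cDθ : Continuous (fderiv ℝ θ) := hθ.continuous_fderiv (by simp)
  have i1 : Integrable (fun x => fderiv ℝ θ x (om x) * ⟪om x, U x⟫) volume := by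
    have hsupp : Function.support (fun x => fderiv ℝ θ x (om x) * ⟪om x, U x⟫) ⊆ Function.support (fderiv ℝ θ) := by
      intro x hx
      rw [mem_support] at hx ⊢
      intro h
      exact hx (by rw [h, _root_.zero_apply, zero_mul])
    have hK : HasCompactSupport (fderiv ℝ θ) := hθc.fderiv (𝕜 := ℝ)
    exact ((cDθ.clm_apply cω).mul (cω.inner hU.continuous)).integrable_of_hasCompactSupport (hK.mono hsupp)
  have i2 : Integrable (fun x => θ x * ⟪U x, fderiv ℝ om x (om x)⟫) volume :=
    (hθ.continuous.mul (hU.continuous.inner (cDω.clm_apply cω))).integrable_of_hasCompactSupport hθc.mul_right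
  have i3 : Integrable (fun x => θ x * ⟪om x, fderiv ℝ U x (om x)⟫) volume :=
    (hθ.continuous.mul (cω.inner (cDU.clm_apply cω))).integrable_of_hasCompactSupport hθc.mul_right
  have i12 : Integrable (fun x => fderiv ℝ θ x (om x) * ⟪om x, U x⟫ + θ x * ⟪U x, fderiv ℝ om x (om x)⟫) volume :=
    i1.add i2
  rw [integral_add i12 i3, integral_add i1 i2] at h0
  linarith

/-! ## 2. The bound on the localised stretching: the small factor is `sup‖v − c‖`, not `sup‖Dv‖` -/

/-- **`|S_θ| ≤ (σ/2)(λZ_θ + λ⁻¹W_θ) + σ∫‖Dθ‖‖ω‖²`** for every `λ > 0`, where `σ ≥ ‖v − c‖` on `tsupport θ`, `0 ≤ θ`,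
`Z_θ = ∫θ‖ω‖²`, `W_θ = ∫θ|Dω|²_F` (Young's inequality on `θ‖v−c‖‖ω‖‖Dω‖ ≤ θσ‖ω‖√|Dω|²_F` after
`integral_weightedStretching_eq` with `U = v − c`). [folklore] -/
theorem abs_integral_weightedStretching_le (hv : ContDiff ℝ ∞ v)
    (h1 : ∫⁻ x, ‖iteratedFDeriv ℝ 1 v x‖ₑ ^ 2 < ⊤) (h2 : ∫⁻ x, ‖iteratedFDeriv ℝ 2 v x‖ₑ ^ 2 < ⊤)
    (hθ : ContDiff ℝ ∞ θ) (hθc : HasCompactSupport θ) (hθ0 : ∀ x, 0 ≤ θ x)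
    {σ : ℝ} (hσ0 : 0 ≤ σ) (hσ : ∀ x ∈ tsupport θ, ‖v x - c‖ ≤ σ) {lam : ℝ} (hlam : 0 < lam) :
    |∫ x, θ x * ⟪curl v x, fderiv ℝ v x (curl v x)⟫| ≤
      σ / 2 * (lam * (∫ x, θ x * ‖curl v x‖ ^ 2) + lam⁻¹ * ∫ x, θ x * frobeniusNormSq (fderiv ℝ (curl v) x)) +
        σ * ∫ x, ‖fderiv ℝ θ x‖ * ‖curl v x‖ ^ 2 := by
  have hU : ContDiff ℝ 1 (fun y => v y - c) := (hv.sub contDiff_const).of_le (by norm_cast)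
  have hE := integral_weightedStretching_eq hv hU hθ hθc
  have hDV : ∀ x, fderiv ℝ (fun y => v y - c) x = fderiv ℝ v x := fun x => fderiv_sub_const _
  simp_rw [hDV] at hE
  rw [hE]
  -- names
  have hω : ContDiff ℝ ∞ (curl v) := contDiff_curl_top hv
  have hω1 : ContDiff ℝ 1 (curl v) := hω.of_le (by norm_cast)
  have cω : Continuous (curl v) := hω.continuous
  have cDω : Continuous (fderiv ℝ (curl v)) := hω.continuous_fderiv (by simp)
  have cDθ : Continuous (fderiv ℝ θ) := hθ.continuous_fderiv (by simp)
  have iZ : Integrable (fun x => ‖curl v x‖ ^ 2) volume := (integrable_norm_curl_sq (hv.of_le (by norm_cast)) h1).1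
  have iW : Integrable (fun x => frobeniusNormSq (fderiv ℝ (curl v) x)) volume :=
    (integrable_frobeniusNormSq_fderiv_curl (hv.of_le (by norm_cast)) h2).1
  obtain ⟨Cθ, hCθ⟩ := hθ.continuous.bounded_above_of_compact_support hθc
  have hCθ0 : 0 ≤ Cθ := (norm_nonneg _).trans (hCθ 0)
  have iθZ : Integrable (fun x => θ x * ‖curl v x‖ ^ 2) volume := by
    refine (iZ.const_mul Cθ).mono' ((hθ.continuous.mul (cω.norm.pow 2)).aestronglyMeasurable)
      (Eventually.of_forall fun x => ?_)
    rw [Real.norm_eq_abs, abs_mul, abs_of_nonneg (hθ0 x), abs_of_nonneg (sq_nonneg _)]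
    exact mul_le_mul_of_nonneg_right ((le_abs_self _).trans (by simpa [Real.norm_eq_abs] using hCθ x)) (sq_nonneg _)
  have iθW : Integrable (fun x => θ x * frobeniusNormSq (fderiv ℝ (curl v) x)) volume := by
    refine (iW.const_mul Cθ).mono' ((hθ.continuous.mul (continuous_frobeniusNormSq_fderiv hω1 one_ne_zero)).aestronglyMeasurable)
      (Eventually.of_forall fun x => ?_)
    rw [Real.norm_eq_abs, abs_mul, abs_of_nonneg (hθ0 x), abs_of_nonneg (frobeniusNormSq_nonneg _)]
    exact mul_le_mul_of_nonneg_right ((le_abs_self _).trans (by simpa [Real.norm_eq_abs] using hCθ x))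
      (frobeniusNormSq_nonneg _)
  have iD : Integrable (fun x => ‖fderiv ℝ θ x‖ * ‖curl v x‖ ^ 2) volume := by
    refine (cDθ.norm.mul (cω.norm.pow 2)).integrable_of_hasCompactSupport ?_
    exact ((hθc.fderiv (𝕜 := ℝ)).norm).mul_right
  -- pointwise bounds
  have hθsupp : ∀ x, x ∉ tsupport θ → θ x = 0 := fun x hx => image_eq_zero_of_notMem_tsupport hx
  have hb1 : ∀ x, ‖θ x * ⟪v x - c, fderiv ℝ (curl v) x (curl v x)⟫‖ ≤
      σ / 2 * (lam * (θ x * ‖curl v x‖ ^ 2) + lam⁻¹ * (θ x * frobeniusNormSq (fderiv ℝ (curl v) x))) := by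
    intro x
    by_cases hx : x ∈ tsupport θ
    · have hVσ : ‖v x - c‖ ≤ σ := hσ x hx
      have hθx : 0 ≤ θ x := hθ0 x
      set L := fderiv ℝ (curl v) x
      have hL : ‖L‖ ^ 2 ≤ frobeniusNormSq L := by
        have h := opNorm_le_sqrt_frobeniusNormSq L
        calc ‖L‖ ^ 2 ≤ (Real.sqrt (frobeniusNormSq L)) ^ 2 := by gcongr
          _ = frobeniusNormSq L := Real.sq_sqrt (frobeniusNormSq_nonneg _)
      -- `‖L‖‖ω‖ ≤ (λ‖ω‖² + λ⁻¹‖L‖²)/2`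
      have hyoung : ‖L‖ * ‖curl v x‖ ≤ (lam * ‖curl v x‖ ^ 2 + lam⁻¹ * ‖L‖ ^ 2) / 2 := by
        have hsq : 0 ≤ (lam * ‖curl v x‖ - ‖L‖) ^ 2 := sq_nonneg _
        have hlam' : lam⁻¹ * ‖L‖ ^ 2 = ‖L‖ ^ 2 / lam := by rw [inv_mul_eq_div]
        rw [hlam']
        rw [le_div_iff₀ (by norm_num : (0:ℝ) < 2)]
        have key : 2 * lam * (‖L‖ * ‖curl v x‖) ≤ lam * (lam * ‖curl v x‖ ^ 2) + ‖L‖ ^ 2 := by nlinarith [hsq]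
        have h2 : lam * (lam * ‖curl v x‖ ^ 2 + ‖L‖ ^ 2 / lam) = lam * (lam * ‖curl v x‖ ^ 2) + ‖L‖ ^ 2 := by
          field_simp
        nlinarith [key, h2, hlam]
      calc ‖θ x * ⟪v x - c, L (curl v x)⟫‖ = θ x * |⟪v x - c, L (curl v x)⟫| := by
            rw [norm_mul, Real.norm_eq_abs, abs_of_nonneg (hθ0 x), Real.norm_eq_abs]
        _ ≤ θ x * (‖v x - c‖ * (‖L‖ * ‖curl v x‖)) := by
            refine mul_le_mul_of_nonneg_left ?_ (hθ0 x)
            calc |⟪v x - c, L (curl v x)⟫| ≤ ‖v x - c‖ * ‖L (curl v x)‖ := abs_real_inner_le_norm _ _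
              _ ≤ ‖v x - c‖ * (‖L‖ * ‖curl v x‖) := by gcongr; exact L.le_opNorm _
        _ ≤ θ x * (σ * ((lam * ‖curl v x‖ ^ 2 + lam⁻¹ * ‖L‖ ^ 2) / 2)) := by
            refine mul_le_mul_of_nonneg_left ?_ (hθ0 x)
            exact mul_le_mul hVσ hyoung (by positivity) hσ0
        _ ≤ θ x * (σ * ((lam * ‖curl v x‖ ^ 2 + lam⁻¹ * frobeniusNormSq L) / 2)) := by
            have : lam⁻¹ * ‖L‖ ^ 2 ≤ lam⁻¹ * frobeniusNormSq L := mul_le_mul_of_nonneg_left hL (inv_nonneg.2 hlam.le)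
            gcongr
        _ = σ / 2 * (lam * (θ x * ‖curl v x‖ ^ 2) + lam⁻¹ * (θ x * frobeniusNormSq L)) := by ring
    · rw [hθsupp x hx]
      simp
  have hb2 : ∀ x, ‖fderiv ℝ θ x (curl v x) * ⟪curl v x, v x - c⟫‖ ≤ σ * (‖fderiv ℝ θ x‖ * ‖curl v x‖ ^ 2) := by
    intro x
    by_cases hx : x ∈ tsupport θ
    · have hVσ : ‖v x - c‖ ≤ σ := hσ x hx
      calc ‖fderiv ℝ θ x (curl v x) * ⟪curl v x, v x - c⟫‖ = |fderiv ℝ θ x (curl v x)| * |⟪curl v x, v x - c⟫| := by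
            rw [norm_mul, Real.norm_eq_abs, Real.norm_eq_abs]
        _ ≤ (‖fderiv ℝ θ x‖ * ‖curl v x‖) * (‖curl v x‖ * ‖v x - c‖) := by
            refine mul_le_mul ?_ (abs_real_inner_le_norm _ _) (abs_nonneg _) (by positivity)
            rw [← Real.norm_eq_abs]; exact (fderiv ℝ θ x).le_opNorm _
        _ ≤ (‖fderiv ℝ θ x‖ * ‖curl v x‖) * (‖curl v x‖ * σ) := by gcongr
        _ = σ * (‖fderiv ℝ θ x‖ * ‖curl v x‖ ^ 2) := by ring
    · have hD : fderiv ℝ θ x = 0 := fderiv_of_notMem_tsupport ℝ hx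
      rw [hD]
      simp
  -- integrate
  have hI1 : ‖∫ x, θ x * ⟪v x - c, fderiv ℝ (curl v) x (curl v x)⟫‖ ≤
      σ / 2 * (lam * (∫ x, θ x * ‖curl v x‖ ^ 2) + lam⁻¹ * ∫ x, θ x * frobeniusNormSq (fderiv ℝ (curl v) x)) := by
    have i12 : Integrable (fun x => lam * (θ x * ‖curl v x‖ ^ 2) +
        lam⁻¹ * (θ x * frobeniusNormSq (fderiv ℝ (curl v) x))) volume :=
      (iθZ.const_mul lam).add (iθW.const_mul lam⁻¹)
    have h := norm_integral_le_of_norm_le (i12.const_mul (σ / 2)) (Eventually.of_forall hb1)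
    rw [integral_const_mul, integral_add (iθZ.const_mul lam) (iθW.const_mul lam⁻¹), integral_const_mul,
      integral_const_mul] at h
    exact h
  have hI2 : ‖∫ x, fderiv ℝ θ x (curl v x) * ⟪curl v x, v x - c⟫‖ ≤ σ * ∫ x, ‖fderiv ℝ θ x‖ * ‖curl v x‖ ^ 2 := by
    have h := norm_integral_le_of_norm_le (iD.const_mul σ) (Eventually.of_forall hb2)
    rw [integral_const_mul] at h
    exact h
  rw [Real.norm_eq_abs] at hI1 hI2
  calc |-(∫ x, θ x * ⟪v x - c, fderiv ℝ (curl v) x (curl v x)⟫) - ∫ x, fderiv ℝ θ x (curl v x) * ⟪curl v x, v x - c⟫|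
      ≤ |∫ x, θ x * ⟪v x - c, fderiv ℝ (curl v) x (curl v x)⟫| + |∫ x, fderiv ℝ θ x (curl v x) * ⟪curl v x, v x - c⟫| := by
        rw [show ∀ a b : ℝ, -a - b = -(a + b) from fun a b => by ring, abs_neg]
        exact abs_add_le _ _
    _ ≤ _ := add_le_add hI1 hI2

/-! ## 3. The far-field Caccioppoli inequality: the localised stretching is absorbed -/

/-- **THE FAR-FIELD CACCIOPPOLI INEQUALITY (abstract corrector).**  For the constant-speed residue object
(`‖v‖ ≡ M = ‖c‖`, `|S| = κ⋆M√Z√W`, `M√Z√W > 0`), every weight `θ ∈ C^∞_c(ℝ³;[0,1])` supported where `‖v − c‖ ≤ σ` with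
`3σ ≤ κ⋆M`, and every smooth gradient corrector `∇p` of `(1−θ)(v−c)` (`‖∇p‖ ≤ η`, `‖D∇p‖ ≤ B_p`, `D¹∇p, D²∇p ∈ L²`):
`½κ⋆²M²(W·Z_θ + Z·W_θ) ≤ 3|S|·σ·∫‖Dθ‖‖ω‖² + |S|·|J_×| + κ⋆²M²(W·|A_×| + Z·|C_×|) + |S|·|∫⟪ω, D∇p ω⟫| + κ⋆²M·Z·W·η`,
with `Z_θ = ∫θ‖ω‖²`, `W_θ = ∫θ|Dω|²_F` and `A_×, J_×, C_×` the `∇θ`-cross integrals of `…TruncationExpansion`.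
No hypothesis on `sup‖Dv‖` over the support enters. [folklore] -/
theorem farCaccioppoli_of_gradient_corrector
    (hv : ContDiff ℝ ∞ v) (hdiv : VectorCalculus.IsDivFree v) {M B : ℝ} (hMpos : 0 < M)
    (hM : ∀ x, ‖v x‖ = M) (hcM : ‖c‖ = M) (hB : ∀ x, ‖fderiv ℝ v x‖ ≤ B)
    (h1 : ∫⁻ x, ‖iteratedFDeriv ℝ 1 v x‖ₑ ^ 2 < ⊤) (h2 : ∫⁻ x, ‖iteratedFDeriv ℝ 2 v x‖ₑ ^ 2 < ⊤)
    (hpos : 0 < M * Real.sqrt (Zen v) * Real.sqrt (Wpa v))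
    (hatt : |Jst v| = kStar * M * Real.sqrt (Zen v) * Real.sqrt (Wpa v))
    (hθ : ContDiff ℝ ∞ θ) (hθc : HasCompactSupport θ) (hθ01 : ∀ x, 0 ≤ θ x ∧ θ x ≤ 1)
    {σ : ℝ} (hσ0 : 0 ≤ σ) (hσ : ∀ x ∈ tsupport θ, ‖v x - c‖ ≤ σ) (hσK : 3 * σ ≤ kStar * M)
    {p : E3 → ℝ} (hp : ContDiff ℝ ∞ p) {η Bp : ℝ} (hpη : ∀ x, ‖gradient p x‖ ≤ η)
    (hpB : ∀ x, ‖fderiv ℝ (gradient p) x‖ ≤ Bp)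
    (hp1 : ∫⁻ x, ‖iteratedFDeriv ℝ 1 (gradient p) x‖ₑ ^ 2 < ⊤) (hp2 : ∫⁻ x, ‖iteratedFDeriv ℝ 2 (gradient p) x‖ₑ ^ 2 < ⊤)
    (hudiv : VectorCalculus.IsDivFree (fun x => (1 - θ x) • (v x - c) + gradient p x)) :
    kStar ^ 2 * M ^ 2 * (Wpa v * (∫ x, θ x * ‖curl v x‖ ^ 2) + Zen v * (∫ x, θ x * frobeniusNormSq (fderiv ℝ (curl v) x))) / 2 ≤
      3 * |Jst v| * σ * (∫ x, ‖fderiv ℝ θ x‖ * ‖curl v x‖ ^ 2) +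
        |Jst v| * |∫ x, (⟪cross (gradient θ x) (v x - c), fderiv ℝ v x (curl v x)⟫ +
            (fderiv ℝ θ x (curl v x)) * ⟪curl v x, v x - c⟫ + ⟪curl v x, fderiv ℝ v x (cross (gradient θ x) (v x - c))⟫)| +
        kStar ^ 2 * M ^ 2 * (Wpa v * |∫ x, ⟪curl v x, cross (gradient θ x) (v x - c)⟫| +
          Zen v * |∫ x, ∑ i, ⟪fderiv ℝ (curl v) x (EuclideanSpace.basisFun (Fin 3) ℝ i),
            (fderiv ℝ θ x (EuclideanSpace.basisFun (Fin 3) ℝ i)) • curl v x +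
              cross (fderiv ℝ (gradient θ) x (EuclideanSpace.basisFun (Fin 3) ℝ i)) (v x - c) +
              cross (gradient θ x) (fderiv ℝ v x (EuclideanSpace.basisFun (Fin 3) ℝ i))⟫|) +
        |Jst v| * |∫ x, ⟪curl v x, fderiv ℝ (gradient p) x (curl v x)⟫| +
        kStar ^ 2 * M * Zen v * Wpa v * η := by
  -- abbreviations
  set S : ℝ := Jst v with hSdef
  set Z : ℝ := Zen v with hZdef
  set W : ℝ := Wpa v with hWdef
  set Zθ : ℝ := ∫ x, θ x * ‖curl v x‖ ^ 2 with hZθ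
  set Wθ : ℝ := ∫ x, θ x * frobeniusNormSq (fderiv ℝ (curl v) x) with hWθ
  set Sθ : ℝ := ∫ x, θ x * ⟪curl v x, fderiv ℝ v x (curl v x)⟫ with hSθ
  set Dθ : ℝ := ∫ x, ‖fderiv ℝ θ x‖ * ‖curl v x‖ ^ 2 with hDθ
  set Jx : ℝ := ∫ x, (⟪cross (gradient θ x) (v x - c), fderiv ℝ v x (curl v x)⟫ +
      (fderiv ℝ θ x (curl v x)) * ⟪curl v x, v x - c⟫ + ⟪curl v x, fderiv ℝ v x (cross (gradient θ x) (v x - c))⟫) with hJx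
  set Ax : ℝ := ∫ x, ⟪curl v x, cross (gradient θ x) (v x - c)⟫ with hAx
  set Cx : ℝ := ∫ x, ∑ i, ⟪fderiv ℝ (curl v) x (EuclideanSpace.basisFun (Fin 3) ℝ i),
      (fderiv ℝ θ x (EuclideanSpace.basisFun (Fin 3) ℝ i)) • curl v x +
        cross (fderiv ℝ (gradient θ) x (EuclideanSpace.basisFun (Fin 3) ℝ i)) (v x - c) +
        cross (gradient θ x) (fderiv ℝ v x (EuclideanSpace.basisFun (Fin 3) ℝ i))⟫ with hCx
  set PH : ℝ := ∫ x, ⟪curl v x, fderiv ℝ (gradient p) x (curl v x)⟫ with hPH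
  -- signs and positivity
  have hZ0 : 0 ≤ Z := integral_nonneg fun x => sq_nonneg _
  have hW0 : 0 ≤ W := integral_nonneg fun x => frobeniusNormSq_nonneg _
  set a : ℝ := Real.sqrt Z with hadef
  set b : ℝ := Real.sqrt W with hbdef
  have ha2 : a ^ 2 = Z := Real.sq_sqrt hZ0
  have hb2 : b ^ 2 = W := Real.sq_sqrt hW0
  have ha0 : 0 ≤ a := Real.sqrt_nonneg _
  have hb0 : 0 ≤ b := Real.sqrt_nonneg _
  have hab : 0 < a * b := by
    have : 0 < M * (a * b) := by rw [← mul_assoc]; exact hpos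
    exact (pos_iff_pos_of_mul_pos this).1 hMpos
  have ha' : 0 < a := lt_of_le_of_ne ha0 (fun h => by rw [← h, zero_mul] at hab; exact lt_irrefl _ hab)
  have hb' : 0 < b := lt_of_le_of_ne hb0 (fun h => by rw [← h, mul_zero] at hab; exact lt_irrefl _ hab)
  have hK0 : 0 < kStar := kStar_pos
  have hZθ0 : 0 ≤ Zθ := integral_nonneg fun x => mul_nonneg (hθ01 x).1 (sq_nonneg _)
  have hWθ0 : 0 ≤ Wθ := integral_nonneg fun x => mul_nonneg (hθ01 x).1 (frobeniusNormSq_nonneg _)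
  -- (1) the localised KKT inequality with the abstract corrector, expanded
  have h := firstVariation_smul_ge_of_gradient_corrector hv hdiv hMpos hM hcM hB h1 h2 hatt hθ hθc hθ01 hp hpη hpB
    hp1 hp2 hudiv
  rw [firstVar_stretching_smul hv hB h1 hθ hθc hθ01 c, firstVar_enstrophy_smul hv h1 hθ hθc hθ01 c,
    firstVar_palinstrophy_smul hv h2 hθ hθc hθ01 c] at h
  change S * (3 * Sθ + Jx) - kStar ^ 2 * M ^ 2 * (W * (Zθ + Ax) + Z * (Wθ + Cx)) ≥ S * PH - kStar ^ 2 * M * Z * W * η at h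
  -- (2) the localised stretching, with `λ = b/a`
  have hlam : 0 < b / a := div_pos hb' ha'
  have hSθ_le := abs_integral_weightedStretching_le (c := c) hv h1 h2 hθ hθc (fun x => (hθ01 x).1) hσ0 hσ hlam
  change |Sθ| ≤ σ / 2 * (b / a * Zθ + (b / a)⁻¹ * Wθ) + σ * Dθ at hSθ_le
  -- from here on only real arithmetic: forget the bodies of the abbreviations
  clear_value S Z W Zθ Wθ Sθ Dθ Jx Ax Cx PH a b
  -- `|S|·(σ/2)(λZθ + λ⁻¹Wθ) = (κ⋆Mσ/2)(W Zθ + Z Wθ)`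
  have hkey : |S| * (σ / 2 * (b / a * Zθ + (b / a)⁻¹ * Wθ)) = kStar * M * σ / 2 * (W * Zθ + Z * Wθ) := by
    rw [hatt, ← ha2, ← hb2]
    field_simp
  have e1 : 3 * S * Sθ ≤ 3 * (|S| * |Sθ|) := by
    rw [← abs_mul]; linarith [le_abs_self (S * Sθ)]
  have e2 : |S| * |Sθ| ≤ kStar * M * σ / 2 * (W * Zθ + Z * Wθ) + |S| * (σ * Dθ) := by
    calc |S| * |Sθ| ≤ |S| * (σ / 2 * (b / a * Zθ + (b / a)⁻¹ * Wθ) + σ * Dθ) :=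
          mul_le_mul_of_nonneg_left hSθ_le (abs_nonneg _)
      _ = kStar * M * σ / 2 * (W * Zθ + Z * Wθ) + |S| * (σ * Dθ) := by rw [mul_add, hkey]
  have hsum0 : 0 ≤ W * Zθ + Z * Wθ := add_nonneg (mul_nonneg hW0 hZθ0) (mul_nonneg hZ0 hWθ0)
  have e3 : 3 * (kStar * M * σ / 2 * (W * Zθ + Z * Wθ)) ≤ kStar ^ 2 * M ^ 2 / 2 * (W * Zθ + Z * Wθ) := by
    have hKM0 : 0 ≤ kStar * M := (mul_pos hK0 hMpos).le
    have hc : 3 * (kStar * M * σ / 2) ≤ kStar ^ 2 * M ^ 2 / 2 := by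
      have := mul_le_mul_of_nonneg_left hσK hKM0
      linarith [this]
    have := mul_le_mul_of_nonneg_right hc hsum0
    linarith [this]
  have e4 : S * Jx ≤ |S| * |Jx| := by
    have h4 : S * Jx ≤ |S * Jx| := le_abs_self _
    rw [abs_mul] at h4; exact h4
  have e5 : -(S * PH) ≤ |S| * |PH| := by
    have h5 : -(S * PH) ≤ |S * PH| := neg_le_abs _
    rw [abs_mul] at h5; exact h5
  have hAx' : -Ax ≤ |Ax| := neg_le_abs _
  have hCx' : -Cx ≤ |Cx| := neg_le_abs _
  have e6 : -(W * Ax) ≤ W * |Ax| := by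
    have := mul_le_mul_of_nonneg_left hAx' hW0
    linarith [this]
  have e7 : -(Z * Cx) ≤ Z * |Cx| := by
    have := mul_le_mul_of_nonneg_left hCx' hZ0
    linarith [this]
  have hKM : 0 ≤ kStar ^ 2 * M ^ 2 := by positivity
  have e67 : -(kStar ^ 2 * M ^ 2 * (W * Ax + Z * Cx)) ≤ kStar ^ 2 * M ^ 2 * (W * |Ax| + Z * |Cx|) := by
    have h67 : -(W * Ax + Z * Cx) ≤ W * |Ax| + Z * |Cx| := by linarith
    have := mul_le_mul_of_nonneg_left h67 hKM
    linarith
  have e12 : 3 * S * Sθ ≤ 3 * (kStar * M * σ / 2 * (W * Zθ + Z * Wθ)) + 3 * (|S| * (σ * Dθ)) := by linarith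
  linarith [h, e12, e3, e4, e5, e67]

end ExtremiserLiouville

end Summit.NavierStokesRegularity.NavierStokesRegularity.Theorems

end
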